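import Summits.ValiantsHypothesis.ValiantsHypothesis.Theorems.BarrierLeverDefinableEquationsBoolSumFourier
import Summits.ValiantsHypothesis.ValiantsHypothesis.Theorems.BarrierLeverDefinableEquationsTorusWeights
import Summits.ValiantsHypothesis.ValiantsHypothesis.Theorems.BarrierLeverSigmaLambdaSigmaSliceCertificate
import Literature.Barriers.ValiantsHypothesis.CKRST20IntegerBoxNaturalProofs
import Summits.ValiantsHypothesis.ValiantsHypothesis.Theses.BarrierLever

/-!
# Crux `BarrierLever.DefinableEquations` (stmt-ValiantsHypothesis-8745) / `SingleSizeEquations`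
# (8749) — NORMAL FORM: the witness may be taken to be a WEIGHT VECTOR of the torus
# (isobaric for `x ↦ (t^{u_i} x_i)`, and homogeneous)

Write `Eq(n, b, a)` for the inner statement of the crux at one `n` (a nonzero level-`a` Boolean sum
`E = boolSum H` in the `N = C(2n,n)` coefficient variables `c_m`, `|m| ≤ n`, vanishing at `coeff f`
for every `f ∈ SmallCircuits ℂ n b`) and `IsoEq(n, b, a)` for the same WITH the extra requirement
that `E` is homogeneous of some degree `d` AND isobaric of some weight `w_i` for each of the `n`
coordinate torus gradings `c_m ↦ m_i` — i.e. `E` is a weight vector of weight `(d; w_0, …, w_{n-1})`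
for the action of `ℂ^× · (ℂ^×)^n` on `Sym^{≤ n}(ℂ^n)^*` (every monomial `∏ c_m^{α_m}` of `E` has
`Σ_m α_m = d` and `Σ_m α_m m_i = w_i`).

THEOREM (`definableEquations_iff_isobaric`, `singleSizeEquations_iff_isobaric`).
`DefinableEquations ↔ ∃ a ∀ b ∃ n₀ ∀ n ≥ n₀, IsoEq(n, b, a)`, and likewise for `SingleSizeEquations`
(`∀ b ∃ a …`).  Pointwise: `Eq(n, b+2, a) → IsoEq(n, b, a+3)` for `n ≥ 64`, `n ≥ 2a + 6`
(`isoEq_of_eq`).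

PROOF.  (1) TORUS STABILITY: for `f ∈ SmallCircuits ℂ n b` and `t ∈ ℂ`, the polynomial
`t^{u₀} f(t^{u_1} x_1, …, t^{u_n} x_n)` has size `≤ L(f) + n + 1 ≤ n^{b+2}` and the same degree, and
its coefficient vector is `(t^{W m} coeff_m f)_m` with `W m = u₀ + Σ_i u_i m_i`
(`coeff_torusTranslate`); so an equation `E` at rung `b + 2` vanishes on the whole torus orbit of
`coeff f`, hence (tree: `Isobaric.eval_weightedHomogeneousComponent_eq_zero`) EVERY `W`-isobaric
component `E_J` vanishes at `coeff f`.  (2) ONE combined weight `W m = B^n + Σ_i B^i m_i`,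
`B = n N^a + 1`, separates degree and all coordinate weights at once (base-`B` digits,
`digits_inj`): a `W`-isobaric polynomial whose monomials have degree `< B/n` is a weight vector.
(3) `E ≠ 0` has a nonzero component `E_J`, and by the Fourier extraction of
`…BoolSumFourier.lean` (`exists_boolSum_eq_weightedHomogeneousComponent`, with `L = N` new Boolean
variables — `deg_W E ≤ N^{(a+1)(n+1)} < 2^N` once `2n(a+1)(n+1) < 2^n ≤ N`) it is a Boolean sum of
level `a + 3`.  Pure bookkeeping over the tree's definitions; no definitions, no named facts.

WHY (honest framing).  This is the T-weight half of the route's GCT normal form (highest-weight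
vectors of `I(V)_d` are in particular weight vectors); it shrinks the search space for a
constructive witness and costs three levels.  It does NOT touch the open content of the crux
(Chatterjee–Tengse 2023 §1.3 dir. 2), 8746, 14610 or VP vs VNP.  References: [Burgisser2000] §2.1;
[ForbesShpilkaVolk2018] Def. 1; [LandsbergGCT2017] §8 (weight vectors of `GL`-modules).
-/

-- layout Summits/ValiantsHypothesis/ValiantsHypothesis forces the duplicated namespace component
set_option linter.dupNamespace false

noncomputable section

open MvPolynomial

namespace Summit.ValiantsHypothesis.ValiantsHypothesis.Theorems.BarrierLever.IsobaricEquations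

open Literature.Computability.AlgebraicComplexity Literature.Barriers.ValiantsHypothesis
open Summit.ValiantsHypothesis.ValiantsHypothesis.Theorems.BarrierLever.SuccinctHittingSetsForVP
open Summit.ValiantsHypothesis.ValiantsHypothesis.Theorems.BarrierLever.BoolSumComponents

/-! ## §3 The normal form -/

section normalform

variable {n : ℕ}

/-- `deg (boolSum H) ≤ deg H` (substituting constants for the Boolean variables does not raise the
degree). [cite: Burgisser2000, §2.1] -/
theorem totalDegree_boolSum_le {ι : Type*} {q : ℕ} (H : MvPolynomial (ι ⊕ Fin q) ℂ) :
    (boolSum H).totalDegree ≤ H.totalDegree := by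
  unfold boolSum
  refine totalDegree_finsetSum_le fun e _ => ?_
  rw [show aeval (Sum.elim X fun j => if e j then (1 : MvPolynomial ι ℂ) else 0) H =
      bind₁ (Sum.elim X fun j => if e j then (1 : MvPolynomial ι ℂ) else 0) H from rfl]
  refine (Literature.Barriers.ValiantsHypothesis.FSV2018.totalDegree_bind₁_le_mul _ 1
    (fun v => ?_) H).trans (by rw [mul_one])
  rcases v with i | j
  · rw [Sum.elim_inl, totalDegree_X]
  · rw [Sum.elim_inr]
    split_ifs
    · rw [totalDegree_one]; exact Nat.zero_le _
    · rw [totalDegree_zero]; exact Nat.zero_le _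

/-- `deg_W E ≤ deg E · W_max` when every variable has weight `≤ W_max`. [folklore] -/
theorem weightedTotalDegree_le {ι : Type*} (W : ι → ℕ) (Wmax : ℕ) (hW : ∀ m, W m ≤ Wmax)
    (E : MvPolynomial ι ℂ) : weightedTotalDegree W E ≤ E.totalDegree * Wmax := by
  classical
  unfold weightedTotalDegree
  refine Finset.sup_le fun α hα => ?_
  calc Finsupp.weight W α = ∑ m ∈ α.support, α m * W m := by
        simp only [Finsupp.weight_apply, Finsupp.sum, smul_eq_mul]
    _ ≤ ∑ m ∈ α.support, α m * Wmax := Finset.sum_le_sum fun m _ => Nat.mul_le_mul_left _ (hW m)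
    _ = (α.sum fun _ e => e) * Wmax := by rw [Finsupp.sum, Finset.sum_mul]
    _ ≤ E.totalDegree * Wmax := Nat.mul_le_mul_right _ (le_totalDegree hα)

/-- `|degLEMonomials n| = C(2n,n)`. [folklore] -/
theorem card_degLEMonomials (n : ℕ) [Fintype (degLEMonomials n)] :
    Fintype.card (degLEMonomials n) = (2 * n).choose n := by
  rw [← Nat.card_eq_fintype_card, ← monomialsDegLE_self, CKRST2020.natCard_monomialsDegLE, two_mul]

/-- Size arithmetic at `n ≥ 64`: `N = C(2n,n)` satisfies `5 ≤ N`, `n < N`, `n³ < N`, `N ≤ 4^n`.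
[folklore] -/
theorem N_arith (hn : 64 ≤ n) :
    5 ≤ (2 * n).choose n ∧ n < (2 * n).choose n ∧ n ^ 3 < (2 * n).choose n ∧
      (2 * n).choose n ≤ 4 ^ n := by
  have h2 := Literature.ModelTheory.FiniteModelTheory.two_pow_le_choose_two_mul_self n
  have h3 : n ^ 3 < 2 ^ n := SigmaLambdaSigmaSlice.pow_lt_two_pow_of_le 3 n (by norm_num; omega)
  have hn3 : n ≤ n ^ 3 := Nat.le_self_pow (by norm_num) n
  have h64 : (2 : ℕ) ^ 6 ≤ 2 ^ n := Nat.pow_le_pow_right (by norm_num) (by omega)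
  refine ⟨by norm_num at h64; omega, by omega, by omega, ?_⟩
  rw [← Nat.centralBinom_eq_two_mul_choose]; exact Nat.centralBinom_le_four_pow n

/-- Level arithmetic: with `N ≥ 5`, the three budgets of the extracted witness fit into `N^(a+3)`.
[folklore] -/
theorem level_arith {N a q c d : ℕ} (hN : 5 ≤ N) (hq : q ≤ N ^ a) (hc : c ≤ N ^ a) (hd : d ≤ N ^ a) :
    q + N ≤ N ^ (a + 3) ∧ c + N * (3 * N + 1) + 3 * N + 2 ≤ N ^ (a + 3) ∧
      d * (N + 1) + N ≤ N ^ (a + 3) := by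
  have h1 : 1 ≤ N ^ a := Nat.one_le_pow _ _ (by omega)
  have hcube : N ^ (a + 3) = N ^ a * (N * N * N) := by ring
  have hX : ∀ X : ℕ, X ≤ N ^ a * X := fun X => Nat.le_mul_of_pos_left X h1
  rw [hcube]
  refine ⟨?_, ?_, ?_⟩
  · calc q + N ≤ N ^ a + N ^ a * N := Nat.add_le_add hq (hX N)
      _ = N ^ a * (N + 1) := by ring
      _ ≤ N ^ a * (N * N * N) := Nat.mul_le_mul_left _ (by nlinarith)
  · calc c + N * (3 * N + 1) + 3 * N + 2
        ≤ N ^ a + N ^ a * (N * (3 * N + 1) + 3 * N + 2) := by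
          have := hX (N * (3 * N + 1) + 3 * N + 2); omega
      _ = N ^ a * (3 * N * N + 4 * N + 3) := by ring
      _ ≤ N ^ a * (N * N * N) := Nat.mul_le_mul_left _ (by nlinarith)
  · calc d * (N + 1) + N ≤ N ^ a * (N + 1) + N ^ a * N :=
          Nat.add_le_add (Nat.mul_le_mul_right _ hd) (hX N)
      _ = N ^ a * (2 * N + 1) := by ring
      _ ≤ N ^ a * (N * N * N) := Nat.mul_le_mul_left _ (by nlinarith)

/-- Weighted-degree arithmetic: at `n ≥ 64`, `n ≥ 2a + 6`, the combined weight of a level-`a`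
equation is `< 2^N`: `N^a (n+1) (nN^a+1)^n < 2^N`. [folklore] -/
theorem wdeg_arith {a : ℕ} (hn : 64 ≤ n) (ha : 2 * a + 6 ≤ n) :
    (2 * n).choose n ^ a * ((n + 1) * (n * (2 * n).choose n ^ a + 1) ^ n) <
      2 ^ (2 * n).choose n := by
  obtain ⟨h5, hnN, hn3, h4⟩ := N_arith hn
  set N := (2 * n).choose n with hNdef
  have hNa : 1 ≤ N ^ a := Nat.one_le_pow _ _ (by omega)
  have hB : n * N ^ a + 1 ≤ N ^ (a + 1) := by
    rw [pow_succ]; nlinarith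
  have hn1 : n + 1 ≤ N := hnN
  calc N ^ a * ((n + 1) * (n * N ^ a + 1) ^ n)
      ≤ N ^ a * (N * (N ^ (a + 1)) ^ n) :=
        Nat.mul_le_mul_left _ (Nat.mul_le_mul hn1 (Nat.pow_le_pow_left hB n))
    _ = N ^ ((a + 1) * (n + 1)) := by rw [← pow_mul]; ring
    _ ≤ (4 ^ n) ^ ((a + 1) * (n + 1)) := Nat.pow_le_pow_left h4 _
    _ = 2 ^ (2 * n * ((a + 1) * (n + 1))) := by
        rw [show (4 : ℕ) = 2 ^ 2 by norm_num, ← pow_mul, ← pow_mul]; ring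
    _ < 2 ^ N := Nat.pow_lt_pow_right (by norm_num) ?_
  -- `2n(a+1)(n+1) ≤ n³ < N`
  have hq : 2 * (a + 1) * (n + 1) ≤ n * n := by nlinarith
  calc 2 * n * ((a + 1) * (n + 1)) = n * (2 * (a + 1) * (n + 1)) := by ring
    _ ≤ n * (n * n) := Nat.mul_le_mul_left n hq
    _ = n ^ 3 := by ring
    _ < N := hn3

/-- **Pointwise normal form `Eq(n, b+2, a) → IsoEq(n, b, a+3)`** (`n ≥ 64`, `n ≥ 2a + 6`): from a
nonzero level-`a` Boolean-sum equation against `SmallCircuits ℂ n (b+2)` one obtains a nonzero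
level-`(a+3)` Boolean-sum equation against `SmallCircuits ℂ n b` which is HOMOGENEOUS and ISOBARIC
for every coordinate torus grading `c_m ↦ m_i`. [folklore] -/
theorem isoEq_of_eq {a b : ℕ} (hn : 64 ≤ n) (ha : 2 * a + 6 ≤ n)
    (h : ∃ q : ℕ, q ≤ (Nat.choose (2 * n) n) ^ a ∧
      ∃ H : MvPolynomial (↥(degLEMonomials n) ⊕ Fin q) ℂ,
        complexity H ≤ (Nat.choose (2 * n) n) ^ a ∧ H.totalDegree ≤ (Nat.choose (2 * n) n) ^ a ∧
        boolSum H ≠ 0 ∧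
        ∀ f ∈ SmallCircuits ℂ n (b + 2), eval (coeffVector (degLEMonomials n) f) (boolSum H) = 0) :
    ∃ q : ℕ, q ≤ (Nat.choose (2 * n) n) ^ (a + 3) ∧
      ∃ H : MvPolynomial (↥(degLEMonomials n) ⊕ Fin q) ℂ,
        complexity H ≤ (Nat.choose (2 * n) n) ^ (a + 3) ∧
        H.totalDegree ≤ (Nat.choose (2 * n) n) ^ (a + 3) ∧ boolSum H ≠ 0 ∧
        (∀ f ∈ SmallCircuits ℂ n b, eval (coeffVector (degLEMonomials n) f) (boolSum H) = 0) ∧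
        ∃ (d : ℕ) (w : Fin n → ℕ), (boolSum H).IsHomogeneous d ∧
          ∀ i : Fin n, IsWeightedHomogeneous
            (fun m : degLEMonomials n => (m : Fin n →₀ ℕ) i) (boolSum H) (w i) := by
  classical
  obtain ⟨q, hq, H, hc, hd, hne, hvan⟩ := h
  haveI : Fintype (degLEMonomials n) := (Finsupp.finite_of_degree_le (σ := Fin n) n).fintype
  obtain ⟨h5, hnN, -, -⟩ := N_arith hn
  set N := (2 * n).choose n with hNdef
  set E := boolSum H with hEdef
  set B := n * N ^ a + 1 with hBdef
  set W : degLEMonomials n → ℕ := fun m => B ^ n + ∑ i : Fin n, B ^ (i : ℕ) * (m : Fin n →₀ ℕ) i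
    with hWdef
  have hB : 0 < B := Nat.succ_pos _
  -- weighted degree of `E`
  have hdegE : E.totalDegree ≤ N ^ a := (totalDegree_boolSum_le H).trans hd
  have hWmax : ∀ m : degLEMonomials n, W m ≤ (n + 1) * B ^ n := by
    intro m
    have hB1 : 1 ≤ B := hB
    have hsum : ∑ i : Fin n, B ^ (i : ℕ) * (m : Fin n →₀ ℕ) i ≤ B ^ n * n := by
      calc ∑ i : Fin n, B ^ (i : ℕ) * (m : Fin n →₀ ℕ) i
          ≤ ∑ i : Fin n, B ^ n * (m : Fin n →₀ ℕ) i := Finset.sum_le_sum fun i _ =>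
            Nat.mul_le_mul_right _ (Nat.pow_le_pow_right hB1 i.2.le)
        _ = B ^ n * ∑ i : Fin n, (m : Fin n →₀ ℕ) i := by rw [Finset.mul_sum]
        _ ≤ B ^ n * n := Nat.mul_le_mul_left _ ?_
      calc ∑ i : Fin n, (m : Fin n →₀ ℕ) i = (m : Fin n →₀ ℕ).degree := by
            rw [Finsupp.degree_apply]
            exact (Finset.sum_subset (Finset.subset_univ _) fun i _ hi =>
              Finsupp.notMem_support_iff.mp hi).symm
        _ ≤ n := m.2
    calc W m = B ^ n + ∑ i : Fin n, B ^ (i : ℕ) * (m : Fin n →₀ ℕ) i := rfl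
      _ ≤ B ^ n + B ^ n * n := Nat.add_le_add_left hsum _
      _ = (n + 1) * B ^ n := by ring
  have hK : weightedTotalDegree W E < 2 ^ N := by
    calc weightedTotalDegree W E ≤ E.totalDegree * ((n + 1) * B ^ n) :=
          weightedTotalDegree_le W _ hWmax E
      _ ≤ N ^ a * ((n + 1) * B ^ n) := Nat.mul_le_mul_right _ hdegE
      _ < 2 ^ N := wdeg_arith hn ha
  -- a nonzero component
  obtain ⟨J, hJmem, hJne⟩ : ∃ J ∈ Finset.range (weightedTotalDegree W E + 1),
      weightedHomogeneousComponent W J E ≠ 0 := by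
    by_contra hall
    push Not at hall
    apply hne
    rw [hEdef, ← Isobaric.sum_weightedHomogeneousComponent_range W (boolSum H)
      (weightedTotalDegree W E) (fun d hd => le_weightedTotalDegree W hd)]
    exact Finset.sum_eq_zero hall
  have hJ : J < 2 ^ N := lt_of_le_of_lt (Nat.lt_succ_iff.mp (Finset.mem_range.mp hJmem)) hK
  -- Fourier extraction
  obtain ⟨H', hsum', hc', hd'⟩ :=
    exists_boolSum_eq_weightedHomogeneousComponent W H (L := N) (J := J) hK hJ
  obtain ⟨lq, lc, ld⟩ := level_arith (a := a) (q := q) (c := complexity H) (d := H.totalDegree)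
    h5 hq hc hd
  refine ⟨q + N, lq, H', ?_, ?_, ?_, ?_, ?_⟩
  · refine hc'.trans ?_
    rw [card_degLEMonomials]
    exact lc
  · exact hd'.trans ld
  · rw [hsum']; exact hJne
  · intro f hf
    rw [hsum']
    have := eval_component_eq_zero (by omega) hvan (B ^ n) (fun i => B ^ (i : ℕ)) J hf
    exact this
  · rw [hsum']
    refine weightVector_of_combined hB (weightedHomogeneousComponent_isWeightedHomogeneous J E)
      (fun α hα => ?_) hJne
    have hαE : α ∈ E.support := by
      rw [mem_support_iff, coeff_weightedHomogeneousComponent] at hα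
      rw [mem_support_iff]
      intro h0; exact hα (by rw [h0, ite_self])
    have hdegα : α.degree ≤ N ^ a := by
      rw [Finsupp.degree_apply]
      exact (le_totalDegree hαE).trans hdegE
    constructor
    · calc n * α.degree ≤ n * N ^ a := Nat.mul_le_mul_left _ hdegα
        _ < B := Nat.lt_succ_self _
    · calc α.degree ≤ N ^ a := hdegα
        _ ≤ n * N ^ a := Nat.le_mul_of_pos_left _ (by omega)
        _ < B := Nat.lt_succ_self _

end normalform

/-! ## §4 The crux and the support item in isobaric normal form -/

/-- **`DefinableEquations` in isobaric normal form**: the crux holds iff it holds with witnesses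
whose Boolean sum is a weight vector of the torus `ℂ^× · (ℂ^×)^n` — homogeneous of some degree
`d` and isobaric of some weight `w_i` for each coordinate grading `c_m ↦ m_i` (one level `a` for
every `b`). [cite: ForbesShpilkaVolk2018, Def. 1] -/
theorem definableEquations_iff_isobaric :
    Summit.ValiantsHypothesis.ValiantsHypothesis.Theses.BarrierLever.DefinableEquations ↔
      ∃ a : ℕ, ∀ b : ℕ, ∃ n₀ : ℕ, ∀ n ≥ n₀, ∃ q : ℕ, q ≤ (Nat.choose (2 * n) n) ^ a ∧
        ∃ H : MvPolynomial (↥(degLEMonomials n) ⊕ Fin q) ℂ,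
          complexity H ≤ (Nat.choose (2 * n) n) ^ a ∧ H.totalDegree ≤ (Nat.choose (2 * n) n) ^ a ∧
          boolSum H ≠ 0 ∧
          (∀ f ∈ SmallCircuits ℂ n b, eval (coeffVector (degLEMonomials n) f) (boolSum H) = 0) ∧
          ∃ (d : ℕ) (w : Fin n → ℕ), (boolSum H).IsHomogeneous d ∧
            ∀ i : Fin n, IsWeightedHomogeneous
              (fun m : degLEMonomials n => (m : Fin n →₀ ℕ) i) (boolSum H) (w i) := by
  constructor
  · rintro ⟨a, h⟩
    refine ⟨a + 3, fun b => ?_⟩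
    obtain ⟨n₁, hn₁⟩ := h (b + 2)
    refine ⟨max n₁ (max 64 (2 * a + 6)), fun n hn => ?_⟩
    exact isoEq_of_eq (le_trans (le_max_left _ _) ((le_max_right _ _).trans hn))
      (le_trans (le_max_right _ _) ((le_max_right _ _).trans hn)) (hn₁ n ((le_max_left _ _).trans hn))
  · rintro ⟨a, h⟩
    refine ⟨a, fun b => ?_⟩
    obtain ⟨n₀, hn₀⟩ := h b
    refine ⟨n₀, fun n hn => ?_⟩
    obtain ⟨q, hq, H, hc, hd, hne, hvan, -⟩ := hn₀ n hn
    exact ⟨q, hq, H, hc, hd, hne, hvan⟩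

/-- **`SingleSizeEquations` in isobaric normal form** (the `∀ b ∃ a` item,
stmt-ValiantsHypothesis-8749): equations at rung `b`, if they exist at all, may be taken to be
weight vectors of the torus (homogeneous and isobaric for every coordinate grading), at the cost
of three levels. [cite: ForbesShpilkaVolk2018, Def. 1] -/
theorem singleSizeEquations_iff_isobaric :
    Summit.ValiantsHypothesis.ValiantsHypothesis.Theses.BarrierLever.SingleSizeEquations ↔
      ∀ b : ℕ, ∃ a n₀ : ℕ, ∀ n ≥ n₀, ∃ q : ℕ, q ≤ (Nat.choose (2 * n) n) ^ a ∧
        ∃ H : MvPolynomial (↥(degLEMonomials n) ⊕ Fin q) ℂ,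
          complexity H ≤ (Nat.choose (2 * n) n) ^ a ∧ H.totalDegree ≤ (Nat.choose (2 * n) n) ^ a ∧
          boolSum H ≠ 0 ∧
          (∀ f ∈ SmallCircuits ℂ n b, eval (coeffVector (degLEMonomials n) f) (boolSum H) = 0) ∧
          ∃ (d : ℕ) (w : Fin n → ℕ), (boolSum H).IsHomogeneous d ∧
            ∀ i : Fin n, IsWeightedHomogeneous
              (fun m : degLEMonomials n => (m : Fin n →₀ ℕ) i) (boolSum H) (w i) := by
  constructor
  · intro h b
    obtain ⟨a, n₁, hn₁⟩ := h (b + 2)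
    refine ⟨a + 3, max n₁ (max 64 (2 * a + 6)), fun n hn => ?_⟩
    exact isoEq_of_eq (le_trans (le_max_left _ _) ((le_max_right _ _).trans hn))
      (le_trans (le_max_right _ _) ((le_max_right _ _).trans hn)) (hn₁ n ((le_max_left _ _).trans hn))
  · intro h b
    obtain ⟨a, n₀, hn₀⟩ := h b
    refine ⟨a, n₀, fun n hn => ?_⟩
    obtain ⟨q, hq, H, hc, hd, hne, hvan, -⟩ := hn₀ n hn
    exact ⟨q, hq, H, hc, hd, hne, hvan⟩

end Summit.ValiantsHypothesis.ValiantsHypothesis.Theorems.BarrierLever.IsobaricEquations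

end
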